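import Mathlib
import Literature.MathematicalPhysics.StatisticalMechanics.CrystallizationSymmetries

/-!
# Crux `ExactCertificate` (stmt-AtomisticToContinuum-11959), line `closure-makes-nogap-exact`:
# the stub `stub_dilate` — dilates of periodic configurations

Support file — nothing here closes an item.  The line's necessity stubs (zero pressure / virial
identity, tangency) test a periodic configuration `P = F + G` of `ℝ³` against its DILATES
`t • P = tF + tG`, `t > 0`.  The tree has translates and isometric images of periodic
configurations (`PeriodicConfiguration.translate`, `PeriodicConfiguration.isometryImage` in
`Literature/MathematicalPhysics/StatisticalMechanics/CrystallizationSymmetries.lean`) but no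
dilation; this file supplies it in existence form:

`stub_dilate : ∀ P t, 0 < t → ∃ Q, #Q.motif = #P.motif ∧ Q.points = (t • ·) '' P.points ∧
  ∀ W, e_W(Q) = e_{W(t ·)}(P)`.

The configuration `Q` is built exactly like `isometryImage`: lattice of periods `tG`, realised
as the Mathlib pull-back `ZLattice.comap` of `G` along the continuous linear equivalence
`x ↦ t⁻¹ • x` (which supplies the `DiscreteTopology` and `IsZLattice` instances), motif `tF`.
The energy identity is a pure reindexing of the lattice `tsum` by `y ↦ t • y` together with
`dist (t • x) (t • y) = t * dist x y`; no summability is needed.  All `[folklore]`.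
-/

noncomputable section

namespace Summit.AtomisticToContinuum.Crystallization.Theorems.ThreeConeCertificateExactCertificate.Dilation

open Literature.MathematicalPhysics.StatisticalMechanics

/-- **Dilates of periodic configurations.**  For a periodic configuration `P = F + G` of `ℝ³`
and `t > 0` there is a periodic configuration `Q = tF + tG` with the same number of motif
points, point set `t • (F + G)`, and energy per particle `e_W(Q) = e_{W(t ·)}(P)` for every
pair potential `W` (reindexing of the lattice sum; no summability needed). [folklore] -/
theorem stub_dilate : ∀ (P : PeriodicConfiguration 3) (t : ℝ), 0 < t →
    ∃ Q : PeriodicConfiguration 3, Q.motif.card = P.motif.card ∧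
      Q.points = (fun x : EuclideanSpace ℝ (Fin 3) => t • x) '' P.points ∧
      ∀ W : ℝ → ℝ, Q.energyPerParticle W = P.energyPerParticle (fun r => W (t * r)) := by
  intro P t ht
  have ht0 : t ≠ 0 := ht.ne'
  -- the continuous linear equivalence `x ↦ t⁻¹ • x`, along which `G` is pulled back to `tG`
  let e : EuclideanSpace ℝ (Fin 3) ≃L[ℝ] EuclideanSpace ℝ (Fin 3) :=
    (LinearEquiv.smulOfNeZero ℝ (EuclideanSpace ℝ (Fin 3)) t⁻¹ (inv_ne_zero ht0)).toContinuousLinearEquiv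
  have he : ∀ x, e x = t⁻¹ • x := fun x => rfl
  -- the dilate `Q = tF + tG`
  let Q : PeriodicConfiguration 3 :=
    { lattice := ZLattice.comap ℝ P.lattice e.toLinearMap
      discrete := inferInstance
      isZLattice := inferInstance
      motif := P.motif.map ⟨fun y => t • y, smul_right_injective _ ht0⟩
      motif_nonempty := (Finset.map_nonempty).2 P.motif_nonempty
      eq_of_sub_mem := by
        intro x hx y hy hxy
        obtain ⟨x', hx', rfl⟩ := Finset.mem_map.1 hx
        obtain ⟨y', hy', rfl⟩ := Finset.mem_map.1 hy
        have h : x' - y' ∈ P.lattice := by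
          rw [ZLattice.comap, Submodule.mem_comap] at hxy
          simpa [he, smul_sub, smul_smul, inv_mul_cancel₀ ht0] using hxy
        simp [P.eq_of_sub_mem x' hx' y' hy' h] }
  -- membership in the lattice of periods: `g ∈ tG ↔ t⁻¹ g ∈ G`
  have hlat : ∀ g, g ∈ Q.lattice ↔ t⁻¹ • g ∈ P.lattice := fun g => by
    show g ∈ ZLattice.comap ℝ P.lattice _ ↔ _
    rw [ZLattice.comap, Submodule.mem_comap]
    rfl
  -- membership in the point set: `z ∈ tF + tG ↔ t⁻¹ z ∈ F + G`
  have hpts : ∀ z, z ∈ Q.points ↔ t⁻¹ • z ∈ P.points := fun z => by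
    constructor
    · rintro ⟨y, hy, g, hg, rfl⟩
      obtain ⟨y', hy', rfl⟩ := Finset.mem_map.1 hy
      refine ⟨y', hy', t⁻¹ • g, (hlat g).1 hg, ?_⟩
      simp [smul_add, smul_smul, inv_mul_cancel₀ ht0]
    · rintro ⟨y', hy', g, hg, h⟩
      refine ⟨t • y', Finset.mem_map.2 ⟨y', hy', rfl⟩, t • g,
        (hlat _).2 (by simpa [smul_smul, inv_mul_cancel₀ ht0] using hg), ?_⟩
      have hz : z = t • (t⁻¹ • z) := by rw [smul_smul, mul_inv_cancel₀ ht0, one_smul]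
      rw [hz, h, smul_add]
  refine ⟨Q, Finset.card_map _, ?_, ?_⟩
  · -- the point set is `t • (F + G)`
    ext z
    rw [hpts, Set.mem_image]
    constructor
    · intro hz
      exact ⟨t⁻¹ • z, hz, by rw [smul_smul, mul_inv_cancel₀ ht0, one_smul]⟩
    · rintro ⟨x, hx, rfl⟩
      rwa [smul_smul, inv_mul_cancel₀ ht0, one_smul]
  · -- the energy identity: reindex the lattice sum by `y ↦ t • y`
    intro W
    unfold PeriodicConfiguration.energyPerParticle
    rw [show Q.motif.card = P.motif.card from Finset.card_map _]
    congr 1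
    rw [show Q.motif = P.motif.map ⟨fun y => t • y, smul_right_injective _ ht0⟩ from rfl,
      Finset.sum_map]
    refine Finset.sum_congr rfl fun x _ => ?_
    simp only [Function.Embedding.coeFn_mk]
    let ε : {y // y ∈ P.points ∧ y ≠ x} ≃ {y // y ∈ Q.points ∧ y ≠ t • x} :=
      (Homeomorph.smulOfNeZero t ht0).toEquiv.subtypeEquiv fun y => by
        simp only [Homeomorph.coe_toEquiv, Homeomorph.smulOfNeZero_apply, ne_eq, hpts,
          smul_smul, inv_mul_cancel₀ ht0, one_smul, smul_right_inj ht0]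
    rw [← Equiv.tsum_eq ε]
    refine tsum_congr fun y => ?_
    have hd : dist (t • x) (t • (y : EuclideanSpace ℝ (Fin 3))) = t * dist x y := by
      rw [dist_smul₀, Real.norm_eq_abs, abs_of_pos ht]
    simp only [ε, Equiv.subtypeEquiv_apply, Homeomorph.coe_toEquiv, Homeomorph.smulOfNeZero_apply,
      hd]

end Summit.AtomisticToContinuum.Crystallization.Theorems.ThreeConeCertificateExactCertificate.Dilation

end
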